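import Summits.QuantumAdvantage.QuantumAdvantage.Theorems.LinnikCubicClassGroupsDegreeOnePrimesEscapeRayClassWindowDH
import Summits.QuantumAdvantage.QuantumAdvantage.Theorems.LinnikCubicClassGroupsDegreeOnePrimesEscapeFrobeniusWindowUnsmoothing
import Literature.NumberTheory.LFunctions.RayClassFiberUnsmoothing
import Summits.QuantumAdvantage.QuantumAdvantage.Theorems.LinnikCubicClassGroupsDegreeOnePrimesEscapeRayClassDHTheta
import HarnessLib

/-!
# Short intervals for cosets of a congruence class group, V: the `ψ_τ`-form (unsmoothing)

Topic `Summits/QuantumAdvantage/QuantumAdvantage/Theorems`, cell B2b-1 (linnik-cubic), PART A (gen 23); helper toward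
the crux `DegreeOnePrimesEscape` (stmt-QuantumAdvantage-11543) — the ray-class counterpart of
`classPsi_shortInterval_dichotomy_dh` (gen 19).  HONEST FRAMING: value = THEOREM (kernel-checked) — NOT summit progress.

`fiberPsi_shortInterval_dichotomy_dh`: for `n > 1`, density constants `b, D, a`, `κ > 0` and a repulsion constant
`0 < c₁ ≤ 1` there are `δ ≤ 1/64`, `a₂`, `c` such that for every `K` of degree `n`, every abelian Frobenius datum `f`
killing the narrow ray `mod 𝔪 ≠ 0` (non-trivial characters non-principal off `𝔪`), every `Q ≥ Q_𝔪` with `|G| ≤ Q⁴`,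
the log-free density in `Q`-form and the repulsion `c₁Q^{−2} ≤ 1 − β₁`: for all `x ≥ Q^{a₂}`, `x^{1−δ} ≤ h ≤ x` and
cosets `τ`, EITHER (no exceptional zero) `||G|(ψ_τ(x+h) − ψ_τ(x)) − h| ≤ κh`, OR (a real `ψ₁` with a real zero `β₁` in
the `c`-window) `||G|(ψ_τ(x+h) − ψ_τ(x)) − (h − ψ₁(τ) I)| ≤ κ·min(1,(1−β₁)log x)·h`,
`I = ((x+h)^{β₁} − x^{β₁})/β₁ = ∫_x^{x+h} t^{β₁−1} dt` — an error RELATIVE to the flat main term (Deuring–Heilbronn).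
Unsmoothing of `rayWindow_dichotomy_dh` by the two-window sandwich `window_sandwich` (gen 17) with collars
`ε = ε₀ log(1 + h/x)`, `ε₀ = e₀ Q^{−2}`.
References: [LagariasMontgomeryOdlyzko1979, §7]; [ThornerZaman2019, Thm. 3.1]; G. Hoheisel (1930).
-/

noncomputable section

open Complex Real Finset NumberField IsDedekindDomain
open scoped NumberField nonZeroDivisors

namespace Summit.QuantumAdvantage.QuantumAdvantage.Theorems.DegreeOnePrimesEscape

open Literature.NumberTheory.LFunctions Literature.NumberTheory.LFunctions.NumberField
  Literature.NumberTheory.LFunctions.EntireEF Literature.NumberTheory.LFunctions.WindowWeight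
  Literature.NumberTheory.LFunctions.AbelianDensity
open scoped Classical

set_option maxHeartbeats 3200000 in
/-- **The coset prime number theorem in short intervals, `ψ_τ`-form, two-sided, with the exceptional character and
Deuring–Heilbronn** (see the module docstring). [cite: LagariasMontgomeryOdlyzko1979, §7]
[cite: ThornerZaman2019, Theorem 3.1] -/
theorem fiberPsi_shortInterval_dichotomy_dh (n : ℕ) (hn : 1 < n) {b D a : ℝ} (hb : 0 < b) (hD : 0 < D)
    (ha : 1 ≤ a) {κ : ℝ} (hκ : 0 < κ) {c₁ : ℝ} (hc₁ : 0 < c₁) (hc₁1 : c₁ ≤ 1) :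
    ∃ δ a₂ c : ℝ, 0 < δ ∧ δ ≤ 1 / 64 ∧ 1 ≤ a₂ ∧ 0 < c ∧ c ≤ 1 / (8 * ((n : ℝ) ^ 2 + 1)) ∧
    ∀ (K : Type) [Field K] [NumberField K], Module.finrank ℚ K = n →
    ∀ (G : Type) [CommGroup G] [Finite G] (𝔪 : Ideal (𝓞 K)) (f : HeightOneSpectrum (𝓞 K) → G)
      (h𝔪 : 𝔪 ≠ ⊥) (hray : ArtinKillsRay 𝔪 f)
      (hsep : ∀ χ : AddChar (Additive G) ℂ, χ ≠ 0 →
        ∃ v : HeightOneSpectrum (𝓞 K), ¬ 𝔪 ≤ v.asIdeal ∧ χ (Additive.ofMul (f v)) ≠ 1) (Q : ℝ),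
      rayCondQ K 𝔪 ≤ Q → (Nat.card G : ℝ) ≤ Q ^ (4 : ℕ) →
      (∀ (T : ℝ), 1 ≤ T → ∀ u : AddChar (Additive G) ℂ → Finset ℂ,
        (∀ ψ, ∀ ρ ∈ u ψ, rayFamF h𝔪 hray hsep ψ ρ = 0 ∧ 1 / 4 ≤ ρ.re ∧ ρ.re < 1 ∧ |ρ.im| ≤ T) →
        ∀ α : ℝ, α ≤ 1 →
          ∑ ψ, ∑ ρ ∈ u ψ with α ≤ ρ.re, (analyticOrderNatAt (rayFamF h𝔪 hray hsep ψ) ρ : ℝ) ≤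
            D * Real.exp (b * (a * Real.log Q + Real.log (T + 4))) ^ (1 - α)) →
      (∀ ψ₁ : AddChar (Additive G) ℂ, ψ₁ + ψ₁ = 0 → ∀ β₁ : ℝ, β₁ < 1 →
        rayFamF h𝔪 hray hsep ψ₁ β₁ = 0 → c₁ * Q ^ (-(2 : ℝ)) ≤ 1 - β₁) →
      (∀ x h : ℝ, Q ^ a₂ ≤ x → x ^ (1 - δ) ≤ h → h ≤ x → ∀ τ : G,
          |(Nat.card G : ℝ) * (fiberPsi 𝔪 f τ (x + h) - fiberPsi 𝔪 f τ x) - h| ≤ κ * h) ∨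
      ∃ (ψ₁ : AddChar (Additive G) ℂ) (β₁ : ℝ), rayFamF h𝔪 hray hsep ψ₁ β₁ = 0 ∧
          1 - c / (Real.log (((discr K).natAbs : ℝ) * ((Ideal.absNorm 𝔪 : ℕ) : ℝ)) + Real.log 4) < β₁ ∧ β₁ < 1 ∧
          ψ₁ + ψ₁ = 0 ∧
        ∀ x h : ℝ, Q ^ a₂ ≤ x → x ^ (1 - δ) ≤ h → h ≤ x → ∀ τ : G,
          |(Nat.card G : ℝ) * (fiberPsi 𝔪 f τ (x + h) - fiberPsi 𝔪 f τ x) -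
              (h - (ψ₁ (Additive.ofMul τ)).re * (((x + h) ^ β₁ - x ^ β₁) / β₁))| ≤
            κ * min 1 ((1 - β₁) * Real.log x) * h := by
  -- precision split: smoothed error `κ/4`, collars `24 ε₀ ≤ (κ/4) c₁ Q^{-2}`
  have hκ4 : 0 < κ / 4 := by positivity
  set e₀ : ℝ := min (1 / 4) (κ * c₁ / 96) with he₀
  have he₀0 : 0 < e₀ := lt_min (by norm_num) (by positivity)
  have he₀1 : e₀ ≤ 1 / 4 := min_le_left _ _
  have he₀κ : e₀ ≤ κ * c₁ / 96 := min_le_right _ _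
  obtain ⟨θ, a₁, c, hθ0, hθ1, ha₁1, hc, hcn, hmain⟩ := rayWindow_dichotomy_dh n hn hb hD ha hκ4 he₀0 he₀1 hc₁ hc₁1
  set δ : ℝ := θ / 8 with hδ
  have hδ0 : 0 < δ := by positivity
  have hδ64 : δ ≤ 1 / 64 := by rw [hδ]; linarith
  refine ⟨δ, a₁, c, hδ0, hδ64, ha₁1, hc, hcn, fun K _ _ hKn G _ _ 𝔪 f h𝔪 hray hsep Q hQK hG hdens hrepul ↦ ?_⟩
  have hK : 1 < Module.finrank ℚ K := by rw [hKn]; exact hn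
  obtain ⟨hQ12, -, -, -, -, -, -⟩ := raySize_facts h𝔪 hK hQK
  have hQ1 : (1 : ℝ) < Q := by linarith
  have hQ0 : (0 : ℝ) < Q := by linarith
  have hm0 : (0 : ℝ) ≤ (Nat.card G : ℝ) := Nat.cast_nonneg _
  -- the collar ratio `ε₀ = e₀ Q^{-2}`
  have hQm2 : 0 < Q ^ (-(2 : ℝ)) := Real.rpow_pos_of_pos hQ0 _
  have hQm2le : Q ^ (-(2 : ℝ)) ≤ 1 := Real.rpow_le_one_of_one_le_of_nonpos hQ1.le (by norm_num)
  set ε₀ : ℝ := e₀ * Q ^ (-(2 : ℝ)) with hε₀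
  have hε₀0 : 0 < ε₀ := mul_pos he₀0 hQm2
  have hε₀Q : e₀ * Q ^ (-(2 : ℝ)) ≤ ε₀ := le_rfl
  have hε₀1 : ε₀ ≤ 1 / 4 := by
    have := mul_le_mul he₀1 hQm2le hQm2.le (by norm_num); rw [hε₀]; linarith
  have hc₁Q1 : c₁ * Q ^ (-(2 : ℝ)) ≤ 1 := (mul_le_mul hc₁1 hQm2le hQm2.le zero_le_one).trans (by norm_num)
  have h24 : 24 * ε₀ ≤ κ / 4 * (c₁ * Q ^ (-(2 : ℝ))) := by
    rw [hε₀]; have := mul_le_mul_of_nonneg_right he₀κ hQm2.le; nlinarith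
  -- the weight and the coset sums in the weighted form of `window_sandwich`
  have hw0 : ∀ (τ : G) (I : Ideal (𝓞 K)), 0 ≤ fiberIndicatorIdeal 𝔪 f τ I :=
    fun τ I ↦ (fiberIndicatorIdeal_mem (𝔪 := 𝔪) (f := f) τ I).1
  have hS : ∀ (τ : G) (g : ℝ → ℝ), (∑' k : ℕ, (∑ I ∈ idealsOfNorm K k, fiberIndicatorIdeal 𝔪 f τ I *
      idealVonMangoldt I) * g (Real.log k)) = smoothedPsiFiber 𝔪 f τ g := fun τ g ↦ rfl
  have hψ : ∀ (τ : G) (y : ℝ),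
      (∑ n ∈ Icc 0 ⌊y⌋₊, ∑ I ∈ idealsOfNorm K n, fiberIndicatorIdeal 𝔪 f τ I * idealVonMangoldt I) =
        fiberPsi 𝔪 f τ y := fun τ y ↦ rfl
  -- conversion of the complex smoothed bounds into real form, in the weighted notation
  have hreal : ∀ (τ : G) (lo hi ε : ℝ) (cc : ℂ) (σ B : ℝ), 0 < ε → ε ≤ lo → lo ≤ hi →
      ‖(Nat.card G : ℂ) * (smoothedPsiFiber 𝔪 f τ (windowTest lo hi ε) : ℂ) -
          fordLaplace (windowTest lo hi ε) (-1) + cc * fordLaplace (windowTest lo hi ε) (-(σ : ℂ))‖ ≤ B →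
      (Nat.card G : ℝ) * (∑' k : ℕ, (∑ I ∈ idealsOfNorm K k, fiberIndicatorIdeal 𝔪 f τ I * idealVonMangoldt I) *
          windowTest lo hi ε (Real.log k)) ≤
          (fordLaplace (windowTest lo hi ε) (-1)).re - cc.re * (fordLaplace (windowTest lo hi ε) (-(σ : ℂ))).re + B ∧
      (fordLaplace (windowTest lo hi ε) (-1)).re - cc.re * (fordLaplace (windowTest lo hi ε) (-(σ : ℂ))).re - B ≤
        (Nat.card G : ℝ) * (∑' k : ℕ, (∑ I ∈ idealsOfNorm K k, fiberIndicatorIdeal 𝔪 f τ I *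
          idealVonMangoldt I) * windowTest lo hi ε (Real.log k)) := by
    intro τ lo hi ε cc σ B hε0' hεlo hlohi hB
    rw [hS]
    have h1 := (Complex.abs_re_le_norm _).trans hB
    have hFreal : (fordLaplace (windowTest lo hi ε) (-(σ : ℂ))).im = 0 :=
      fordLaplace_windowTest_real_im hε0' (by linarith) σ
    simp only [Complex.add_re, Complex.sub_re, Complex.mul_re, Complex.natCast_re, Complex.natCast_im,
      Complex.ofReal_re, Complex.ofReal_im, mul_zero, sub_zero, hFreal] at h1
    rw [abs_le] at h1
    constructor <;> linarith [h1.1, h1.2]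
  -- generic unsmoothing of a two-window smoothed bound
  have hunsm : ∀ (cc : G → ℂ) (σ : ℝ) (μf : ℝ → ℝ), (∀ τ, |(cc τ).re| ≤ 1) → 1 / 2 ≤ σ → σ ≤ 1 →
      (∀ x : ℝ, Q ^ a₁ ≤ x → 0 < μf x ∧ c₁ * Q ^ (-(2 : ℝ)) ≤ μf x) →
      (∀ x η lo hi : ℝ, Q ^ a₁ ≤ x → 0 < η → η ≤ Real.log 2 →
          Real.exp (-(θ / 8) * Real.log x) ≤ 2 * η → Real.log x ≤ lo → lo < hi → hi ≤ Real.log x + η →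
          ∀ τ : G,
          ‖(Nat.card G : ℂ) * (smoothedPsiFiber 𝔪 f τ (windowTest lo hi (ε₀ * η)) : ℂ) -
              fordLaplace (windowTest lo hi (ε₀ * η)) (-1) +
              cc τ * fordLaplace (windowTest lo hi (ε₀ * η)) (-(σ : ℂ))‖ ≤ κ / 4 * x * η * μf x) →
      ∀ x h : ℝ, Q ^ a₁ ≤ x → x ^ (1 - δ) ≤ h → h ≤ x → ∀ τ : G,
        |(Nat.card G : ℝ) * (fiberPsi 𝔪 f τ (x + h) - fiberPsi 𝔪 f τ x) -
            (h - (cc τ).re * (((x + h) ^ σ - x ^ σ) / σ))| ≤ κ * μf x * h := by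
    intro cc σ μf hcc hσ hσ1 hμf hsmooth x h hx hhx hhx' τ
    obtain ⟨hμ0, hμlow⟩ := hμf x hx
    -- the window data at `x ≥ Q^{a₁}`, `x^{1−δ} ≤ h ≤ x`
    have hxQ : Q ≤ x := by
      have : Q ^ (1 : ℝ) ≤ Q ^ a₁ := Real.rpow_le_rpow_of_exponent_le hQ1.le ha₁1
      rw [Real.rpow_one] at this; linarith
    have hx1 : 1 < x := by linarith
    have hx0 : 0 < x := by linarith
    obtain ⟨-, -, hlog12⟩ := log_small_consts
    have hL16 : 2 ≤ Real.log x := hlog12.trans (Real.log_le_log (by norm_num) (hQ12.trans hxQ))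
    have hδpos : 0 < x ^ (1 - δ) := Real.rpow_pos_of_pos hx0 _
    have hh0 : 0 < h := lt_of_lt_of_le hδpos hhx
    set t : ℝ := h / x with ht
    have ht0 : 0 < t := by positivity
    have ht1 : t ≤ 1 := by rw [ht, div_le_one hx0]; exact hhx'
    have hxt : x * t = h := by rw [ht]; field_simp
    have hxh : x + h = x * (1 + t) := by rw [mul_add, mul_one, hxt]
    set η : ℝ := Real.log (1 + t) with hη
    have hη0 : 0 < η := Real.log_pos (by linarith)
    have hη1 : η ≤ Real.log 2 := Real.log_le_log (by linarith) (by linarith)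
    have hηt' : η ≤ t := by
      have := Real.log_le_sub_one_of_pos (show (0 : ℝ) < 1 + t by linarith); rw [hη]; linarith
    have hlogxh : Real.log (x + h) = Real.log x + η := by
      rw [hxh, Real.log_mul hx0.ne' (by linarith), hη]
    have hηx : Real.exp (-(θ / 8) * Real.log x) ≤ 2 * η := by
      have hηt : t / 2 ≤ η := by
        have h1 := Real.one_sub_inv_le_log_of_pos (show (0 : ℝ) < 1 + t by linarith)
        have h2 : t / 2 ≤ 1 - (1 + t)⁻¹ := by
          rw [show 1 - (1 + t)⁻¹ = t / (1 + t) by field_simp; ring]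
          exact div_le_div_of_nonneg_left ht0.le (by linarith) (by linarith)
        linarith
      have h1 : Real.exp (-(θ / 8) * Real.log x) = x ^ (1 - θ / 8) / x := by
        rw [Real.rpow_def_of_pos hx0, eq_div_iff hx0.ne', ← Real.exp_log hx0, ← Real.exp_add, Real.exp_log hx0]
        congr 1; ring
      rw [h1]
      have h2 : x ^ (1 - θ / 8) / x ≤ h / x := div_le_div_of_nonneg_right (by rw [← hδ]; exact hhx) hx0.le
      linarith
    have hxη : x * η ≤ h := by
      have := mul_le_mul_of_nonneg_left hηt' hx0.le; rw [hxt] at this; exact this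
    have hexpη : Real.exp (Real.log x + η) = x + h := by
      rw [Real.exp_add, Real.exp_log hx0, hη, Real.exp_log (by linarith), hxh]
    have h2ε : 2 * (ε₀ * η) < η := by nlinarith
    have hε0 : 0 < ε₀ * η := by positivity
    have hκμ : 0 < κ / 4 * μf x := mul_pos hκ4 hμ0
    have e1 : κ / 4 * x * η * μf x = κ / 4 * μf x * x * η := by ring
    have hBup := hsmooth x η (Real.log x) (Real.log x + η) hx hη0 hη1 hηx le_rfl (by linarith) le_rfl τ
    have hBlo := hsmooth x η (Real.log x + ε₀ * η) (Real.log x + η - ε₀ * η) hx hη0 hη1 hηx (by linarith)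
      (by linarith) (by linarith) τ
    rw [e1] at hBup hBlo
    have hup := (hreal τ (Real.log x) (Real.log x + η) (ε₀ * η) _ σ (κ / 4 * μf x * x * η + 0) hε0 (by linarith)
      (by linarith) (by rw [add_zero]; exact hBup)).1
    have hlow := (hreal τ (Real.log x + ε₀ * η) (Real.log x + η - ε₀ * η) (ε₀ * η) _ σ (κ / 4 * μf x * x * η + 0)
      hε0 (by linarith) (by linarith) (by rw [add_zero]; exact hBlo)).2
    have key := window_sandwich (hw0 τ) hm0 (κ := κ / 4 * μf x) (J := 0) hx1 hh0 hhx' hη0 hlogxh hxη hexpη hε₀0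
      hε₀1 h2ε hL16 hκμ (rU := (cc τ).re) (rD := (cc τ).re) (σ := σ) (hcc τ) (hcc τ) hσ hσ1 hup hlow
    have hmt : (Real.exp (σ * (Real.log x + η)) - Real.exp (σ * Real.log x)) / σ =
        ((x + h) ^ σ - x ^ σ) / σ := by
      rw [Real.rpow_def_of_pos (by linarith : (0:ℝ) < x + h), Real.rpow_def_of_pos hx0, hlogxh]
      ring_nf
    rw [hmt, add_zero, hψ τ, hψ τ] at key
    have h24h : 24 * ε₀ * h ≤ κ / 4 * μf x * h := by
      have := mul_le_mul_of_nonneg_right (h24.trans (mul_le_mul_of_nonneg_left hμlow hκ4.le)) hh0.le; linarith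
    have hκμh : 0 ≤ κ * μf x * h := by positivity
    rw [abs_le]; constructor <;> linarith [key.1, key.2, h24h]
  -- THE DICHOTOMY
  rcases hmain K hKn G 𝔪 f h𝔪 hray hsep Q hQK hG hdens hrepul with hA | ⟨ψ₁, β₁, h0, hwin, hβ1, hreal', hB⟩
  · left
    intro x h hx hhx hhx' τ
    have key := hunsm (fun _ ↦ 0) 1 (fun _ ↦ 1) (fun _ ↦ by simp) (by norm_num) le_rfl
      (fun x _ ↦ ⟨one_pos, hc₁Q1⟩)
      (fun x η lo hi hx hη0 hη1 hηx hlo hlohi hhi τ ↦ by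
        simpa using hA ε₀ x η lo hi hε₀Q hε₀1 hx hη0 hη1 hηx hlo hlohi hhi τ) x h hx hhx hhx' τ
    simpa using key
  · right
    refine ⟨ψ₁, β₁, h0, hwin, hβ1, hreal', fun x h hx hhx hhx' τ ↦ ?_⟩
    have hβhalf : 1 / 2 ≤ β₁ := by
      have hlog4 : 1 < Real.log 4 := by
        rw [show (4:ℝ) = 2 ^ 2 by norm_num, Real.log_pow]; have := Real.log_two_gt_d9; push_cast; linarith
      have hlogd : 0 ≤ Real.log (((discr K).natAbs : ℝ) * ((Ideal.absNorm 𝔪 : ℕ) : ℝ)) :=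
        Real.log_nonneg (one_le_discr_mul_absNorm K h𝔪)
      have hc2 : c ≤ 1 / 2 :=
        hcn.trans (by rw [div_le_div_iff_of_pos_left one_pos (by positivity) (by norm_num)]; nlinarith)
      have : c / (Real.log (((discr K).natAbs : ℝ) * ((Ideal.absNorm 𝔪 : ℕ) : ℝ)) + Real.log 4) ≤ 1 / 2 := by
        rw [div_le_iff₀ (by linarith)]; nlinarith
      linarith
    have hinv : ∀ τ' : G, (ψ₁ (Additive.ofMul τ'))⁻¹ = ψ₁ (Additive.ofMul τ') :=
      fun τ' ↦ (addChar_real_apply hreal' (Additive.ofMul τ')).1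
    have hμf : ∀ x : ℝ, Q ^ a₁ ≤ x → 0 < min 1 ((1 - β₁) * Real.log x) ∧
        c₁ * Q ^ (-(2 : ℝ)) ≤ min 1 ((1 - β₁) * Real.log x) := by
      intro x hx
      have hxQ : Q ≤ x := by
        have : Q ^ (1 : ℝ) ≤ Q ^ a₁ := Real.rpow_le_rpow_of_exponent_le hQ1.le ha₁1
        rw [Real.rpow_one] at this; linarith
      have hL1 : 1 ≤ Real.log x := by
        have := two_lt_log_twelve.le.trans (Real.log_le_log (by norm_num) (hQ12.trans hxQ)); linarith
      have hδlow : c₁ * Q ^ (-(2 : ℝ)) ≤ 1 - β₁ := hrepul ψ₁ hreal' β₁ hβ1 h0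
      refine ⟨lt_min one_pos (mul_pos (by linarith) (by linarith)), le_min hc₁Q1 (hδlow.trans ?_)⟩
      have := mul_le_mul_of_nonneg_left hL1 (by linarith : (0:ℝ) ≤ 1 - β₁); linarith
    have key := hunsm (fun τ' ↦ (ψ₁ (Additive.ofMul τ'))⁻¹) β₁ (fun x ↦ min 1 ((1 - β₁) * Real.log x))
      (fun τ' ↦ by rw [hinv]; exact (addChar_real_apply hreal' (Additive.ofMul τ')).2.2) hβhalf hβ1.le hμf
      (fun x η lo hi hx hη0 hη1 hηx hlo hlohi hhi τ' ↦ hB ε₀ x η lo hi hε₀Q hε₀1 hx hη0 hη1 hηx hlo hlohi hhi τ')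
      x h hx hhx hhx' τ
    rw [hinv] at key
    exact key

end Summit.QuantumAdvantage.QuantumAdvantage.Theorems.DegreeOnePrimesEscape

end
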